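import Mathlib.Analysis.Normed.Module.FiniteDimension
import Mathlib.Topology.MetricSpace.Isometry
import HarnessLib

/-!
# Iterates, fixed points and displacement of affine maps of a normed space

Elementary facts about an affine self-map `τ w = t + R w` (`R` continuous linear) of a real
normed space, proved (used for the deck transformations of the development in
`Literature/Geometry/Lorentzian/EuclideanOfFlat.lean`):

* `exists_iterate_affine_eq` — iterates are affine, `τ^[n] = tₙ + Rⁿ ·`;
* `isometry_affine`, `isometry_iterate` — norm-preserving linear part ⇒ `τ` and its iterates are
  isometries;
* `exists_fixedPoint_of_iterate` — **if some iterate `τ^[k]`, `k ≥ 1`, has a fixed point `x₀`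
  then `τ` has a fixed point**, the barycentre `k⁻¹ ∑_{i<k} τ^[i] x₀` of the orbit (affine maps
  preserve barycentres);
* `exists_le_norm_displacement` — **a fixed-point-free affine map of a finite-dimensional space
  displaces every point by at least some `δ > 0`**: `‖t + R w - w‖ = dist(-t, (R - 1) w)` and
  `-t` lies outside the closed subspace `range (R - 1)`.

## References

* M. Berger, *Geometry I*, Springer (1987), §2.7 (affine maps and barycentres), §9.3
  (fixed points of isometries). [Berger1987]
-/

noncomputable section

open Set Function Metric

namespace Literature.LinearAlgebra

variable {F : Type*} [NormedAddCommGroup F] [NormedSpace ℝ F]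

/-- **Iterates of an affine map are affine**: `(t + R ·)^[n] = tₙ + Rⁿ ·` for some `tₙ`.
[folklore] -/
theorem exists_iterate_affine_eq (t : F) (R : F →L[ℝ] F) (n : ℕ) :
    ∃ tn : F, ∀ w, (fun w ↦ t + R w)^[n] w = tn + (R ^ n) w := by
  induction n with
  | zero => exact ⟨0, fun w ↦ by simp⟩
  | succ n ih =>
    obtain ⟨tn, htn⟩ := ih
    refine ⟨tn + (R ^ n) t, fun w ↦ ?_⟩
    rw [iterate_succ_apply, htn, map_add, pow_succ, mul_apply_eq_comp, add_assoc]

/-- An affine map with norm-preserving linear part is an isometry. [folklore] -/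
theorem isometry_affine (t : F) {R : F →L[ℝ] F} (hR : ∀ x, ‖R x‖ = ‖x‖) :
    Isometry (fun w ↦ t + R w) :=
  Isometry.of_dist_eq fun x y ↦ by rw [dist_eq_norm, dist_eq_norm, add_sub_add_left_eq_sub,
    ← map_sub, hR]

omit [NormedSpace ℝ F] in
/-- Iterates of an isometry are isometries. [folklore] -/
theorem isometry_iterate {τ : F → F} (h : Isometry τ) (n : ℕ) : Isometry τ^[n] := by
  induction n with
  | zero => exact isometry_id
  | succ n ih => rw [iterate_succ]; exact ih.comp h

/-- **An affine map one of whose iterates `τ^[k]`, `k ≥ 1`, has a fixed point has itself a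
fixed point**: the barycentre `k⁻¹ ∑_{i<k} τ^[i] x₀` of the orbit of the fixed point `x₀` of
`τ^[k]`. [folklore] -/
theorem exists_fixedPoint_of_iterate (t : F) (R : F →L[ℝ] F) {k : ℕ} (hk : 0 < k) {x₀ : F}
    (hfix : (fun w ↦ t + R w)^[k] x₀ = x₀) : ∃ c : F, t + R c = c := by
  set τ : F → F := fun w ↦ t + R w with hτ
  refine ⟨(k : ℝ)⁻¹ • ∑ i ∈ Finset.range k, τ^[i] x₀, ?_⟩
  have hk0 : (k : ℝ) ≠ 0 := by exact_mod_cast hk.ne'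
  have hsum : ∑ i ∈ Finset.range k, τ (τ^[i] x₀) = ∑ i ∈ Finset.range k, τ^[i] x₀ := by
    have h1 : ∑ i ∈ Finset.range k, τ (τ^[i] x₀) = ∑ i ∈ Finset.range k, τ^[i + 1] x₀ :=
      Finset.sum_congr rfl fun i _ ↦ by rw [iterate_succ_apply']
    obtain ⟨m, rfl⟩ : ∃ m, k = m + 1 := ⟨k - 1, (Nat.sub_add_cancel hk).symm⟩
    rw [h1, Finset.sum_range_succ (fun i ↦ τ^[i + 1] x₀), Finset.sum_range_succ' (fun i ↦ τ^[i] x₀),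
      hfix, iterate_zero_apply]
  have hτsum : t + R ((k : ℝ)⁻¹ • ∑ i ∈ Finset.range k, τ^[i] x₀) =
      (k : ℝ)⁻¹ • ∑ i ∈ Finset.range k, τ (τ^[i] x₀) := by
    simp only [hτ, Finset.sum_add_distrib, Finset.sum_const, Finset.card_range, smul_add,
      map_smul, map_sum]
    congr 1
    rw [← Nat.cast_smul_eq_nsmul ℝ, smul_smul, inv_mul_cancel₀ hk0, one_smul]
  rw [hτsum, hsum]

/-- **Fixed-point-free affine maps of a finite-dimensional space displace every point by a
definite amount**: if `t + R w ≠ w` for all `w` then `‖t + R w - w‖ ≥ δ > 0` uniformly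
(`-t` is not in the closed subspace `range (R - 1)`). [folklore] -/
theorem exists_le_norm_displacement [FiniteDimensional ℝ F] (t : F) (R : F →L[ℝ] F)
    (hno : ∀ w, t + R w ≠ w) : ∃ δ > 0, ∀ w, δ ≤ ‖t + R w - w‖ := by
  set S : Submodule ℝ F := LinearMap.range ((R : F →ₗ[ℝ] F) - LinearMap.id) with hS
  have hSc : IsClosed (S : Set F) := S.closed_of_finiteDimensional
  have hnot : -t ∉ (S : Set F) := by
    rintro ⟨w, hw⟩
    apply hno w
    have hw' : R w - w = -t := by simpa using hw
    rw [← sub_eq_zero, add_sub_assoc, hw', add_neg_cancel]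
  rw [← hSc.closure_eq] at hnot
  rw [Metric.mem_closure_iff] at hnot
  push Not at hnot
  obtain ⟨δ, hδ, h⟩ := hnot
  refine ⟨δ, hδ, fun w ↦ ?_⟩
  have hmem : R w - w ∈ (S : Set F) := ⟨w, by simp⟩
  have := h (R w - w) hmem
  rw [dist_eq_norm] at this
  have heq : -t - (R w - w) = -(t + R w - w) := by abel
  rwa [heq, norm_neg] at this

end Literature.LinearAlgebra

end
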